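import Summits.CriticalPhenomena.CardyFormulaZ2.Theorems.CardyMagicRigidityPinchResamplingDefsV3
import Literature.Probability.Percolation.ZdFiveArmMonotone
import Literature.Probability.Percolation.FourArmGarbanProofs
import HarnessLib

/-!
# Stub S6 `stub_fiveArmUpperZ2` of line `pinch-resampling` v3 (crux `NestingRigidity`, stmt-CriticalPhenomena-4835):
# audit of `FiveArmUpperZ2` — degenerate radii and the two classical range reductions

Helper module (proofs only; no `def`, no named fact) for the registered stub
`stub_fiveArmUpperZ2 : FiveArmUpperZ2` (`Theorems/CardyMagicRigidityPinchResamplingDefsV3.lean`: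
`∃ C m₀, ∀ m n, m₀ ≤ m → m ≤ n → P_{1/2}(zdFiveArmClusters m n) ≤ C (m/n)²`, the two-radii five-arm
UPPER bound for critical bond percolation on `ℤ²` in the tree's cluster form `zdFiveArmClusters`,
`Literature/Probability/Percolation/ZdFourArmFromFiveArm.lean`).

§1 AUDIT of the degenerate radii (the statement is not accidentally false for small `m`):
* `zdFiveArmClusters_zero_left` — `𝒜₅(A_{0,n}) = ∅` (`siteSphere 0 = box 0 ∖ box 0 = ∅`: no arm can start),
  `real_zdFiveArmClusters_zero_left`;
* `zdFiveArmClusters_eq_empty_of_lt` — `𝒜₅(A_{m,n}) = ∅` for `n < m` (the outer endpoint of an arm would lie in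
  `box n ∖ box (m-1) = ∅`);
* at `m = n ≥ 1` the bound asks `P ≤ C`, i.e. `C ≥ 1` — harmless since `C` is existential; for FIXED `m ≥ 1` and
  `n → ∞` the event forces three open crossings of `A_{m,n}`, so the content is the exponent `2`, as intended.

§2 RANGE REDUCTIONS (sorry-free bookkeeping a prover of the stub may start from):
* `fiveArmUpperZ2_of_ratio` — it suffices to bound `P_{1/2}(𝒜₅(A_{m,n}))` for `m ≥ m₀` and LARGE RATIOS `n ≥ A m`
  only: bounded ratios are free because probabilities are `≤ 1 ≤ A² (m/n)²` there (cf. the tree's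
  `sixArmDecayAlong_of_large_scales`);
* `fiveArmUpperZ2_of_point_quasiMult` — **the classical route to two radii** (Kesten–Sidoravicius–Zhang 1998,
  Lemma 5, (3.7) ⇒ (3.8); Nolin 2008, §4: `π_j(n₁|n₂) π_j(n₂|n₃) ≍ π_j(n₁|n₃)` and Thm. 24 at one radius): the
  POINT upper bound `P(𝒜₅(A_{m₁,n})) ≤ C n⁻²` (Werner's separation-free counting, PCMI 2009 exercise sheet
  "Five-arm exponent"; the tree has its input `E[Z²] ≤ 3`, `CrossingClusterSecondMoment.lean`), the LOWER
  quasi-multiplicativity `c P(𝒜₅(A_{m₁,m})) P(𝒜₅(A_{m,n})) ≤ P(𝒜₅(A_{m₁,n}))` (gluing five arms across `∂B(m)`: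
  Kesten's arm separation, absent from the tree for bond `ℤ²`) and the point LOWER bound `P(𝒜₅(A_{m₁,m})) ≥ c m⁻²`
  together give `FiveArmUpperZ2` with `C/(c c')`.  These three hypotheses are exactly what a from-scratch proof
  of the stub has to supply; none is asserted here.

References: H. Kesten, V. Sidoravicius, Y. Zhang, EJP 3 (1998), Lemma 5; P. Nolin, EJP 13 (2008), §4–§5 and
Rem. 25 (arXiv 0711.4948 numbering: Thm. 23, Rem. 25); W. Werner, PCMI 16 (2009), first exercise sheet;
H. Duminil-Copin, I. Manolescu, V. Tassion, PTRF 181 (2021), Prop. 6.3 and Prop. 6.6.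
-/

noncomputable section

namespace Summit.CriticalPhenomena.CardyFormulaZ2.Cruxes.NestingRigidity.PinchResampling

open MeasureTheory Literature.Probability.Percolation Literature.Probability.LatticeModels

/-! ### §1 Degenerate radii -/

/-- **`𝒜₅(A_{0,n}) = ∅`**: the tree's sphere `siteSphere 0 = box 0 ∖ box 0` is empty, so no arm can start
(`one_le_of_mem_siteSphere`). The bound of `FiveArmUpperZ2` is therefore trivially true at `m = 0` (where
`((0 : ℝ) / n) ^ 2 = 0`). -/
theorem zdFiveArmClusters_zero_left (n : ℕ) : zdFiveArmClusters 0 n = ∅ := by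
  ext ω
  simp only [Set.mem_empty_iff_false, iff_false]
  rintro ⟨x₁, x₂, x₃, y₁, y₂, y₃, W₁, W₂, W₃, hx₁, -⟩
  exact absurd (one_le_of_mem_siteSphere hx₁) (by omega)

/-- `P_{1/2}(𝒜₅(A_{0,n})) = 0`. -/
theorem real_zdFiveArmClusters_zero_left (n : ℕ) :
    (bondPercolation (zdGraph 2) half).real (zdFiveArmClusters 0 n) = 0 := by
  rw [zdFiveArmClusters_zero_left, measureReal_empty]

/-- **`𝒜₅(A_{m,n}) = ∅` for `n < m`**: the outer endpoint `y₁ ∈ siteSphere n ⊆ box n` of the first walk lies in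
the annulus `sqAnnulus m n = box n ∖ box (m - 1)`, impossible when `n ≤ m - 1`. (Outside the range `m ≤ n` of
`FiveArmUpperZ2`; recorded so that no junk value hides there.) -/
theorem zdFiveArmClusters_eq_empty_of_lt {m n : ℕ} (h : n < m) : zdFiveArmClusters m n = ∅ := by
  ext ω
  simp only [Set.mem_empty_iff_false, iff_false]
  rintro ⟨x₁, x₂, x₃, y₁, y₂, y₃, W₁, W₂, W₃, -, -, -, hy₁, -, -, hs₁, -⟩
  have hy : y₁ ∈ sqAnnulus m n := hs₁ y₁ W₁.end_mem_support
  simp only [sqAnnulus, Finset.mem_coe, mem_annulus] at hy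
  simp only [siteSphere, Finset.mem_sdiff] at hy₁
  exact hy.2 (box_mono 2 (by omega) hy₁.1)

/-- **The trivial regime `m ≤ n < A m`**: a probability is at most `1 ≤ A² (m/n)²`. -/
theorem real_zdFiveArmClusters_le_sq_mul {A m n : ℕ} (hm : 1 ≤ m) (hmn : m ≤ n) (hn : n ≤ A * m) :
    (bondPercolation (zdGraph 2) half).real (zdFiveArmClusters m n) ≤ (A : ℝ) ^ 2 * ((m : ℝ) / n) ^ 2 := by
  have hn0 : (0 : ℝ) < n := by exact_mod_cast (show 0 < n by omega)
  have hAmn : (1 : ℝ) ≤ (A : ℝ) * ((m : ℝ) / n) := by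
    rw [mul_div_assoc', le_div_iff₀ hn0, one_mul]
    exact_mod_cast hn
  calc (bondPercolation (zdGraph 2) half).real (zdFiveArmClusters m n) ≤ 1 := measureReal_le_one
    _ ≤ ((A : ℝ) * ((m : ℝ) / n)) ^ 2 := one_le_pow₀ hAmn
    _ = (A : ℝ) ^ 2 * ((m : ℝ) / n) ^ 2 := mul_pow _ _ _

/-! ### §2 Range reductions -/

/-- **Large ratios suffice.** If for some `C`, `m₀` and `A ≥ 1` the bound
`P_{1/2}(𝒜₅(A_{m,n})) ≤ C (m/n)²` holds whenever `m₀ ≤ m` and `A m ≤ n`, then `FiveArmUpperZ2` holds (with the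
constant `max C 0 + A²` and threshold `max m₀ 1`): for `m ≤ n < A m` the probability is `≤ 1 ≤ A² (m/n)²`. -/
theorem fiveArmUpperZ2_of_ratio : (∃ C : ℝ, ∃ m₀ A : ℕ, 1 ≤ A ∧ ∀ m n : ℕ, m₀ ≤ m → A * m ≤ n → (bondPercolation (zdGraph 2) half).real (zdFiveArmClusters m n) ≤ C * ((m : ℝ) / n) ^ 2) → FiveArmUpperZ2 := by
  rintro ⟨C, m₀, A, -, h⟩
  refine ⟨max C 0 + (A : ℝ) ^ 2, max m₀ 1, fun m n hm hmn ↦ ?_⟩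
  have hm₀ : m₀ ≤ m := le_of_max_le_left hm
  have hm1 : 1 ≤ m := le_of_max_le_right hm
  have hq0 : 0 ≤ ((m : ℝ) / n) ^ 2 := by positivity
  have hC : C ≤ max C 0 + (A : ℝ) ^ 2 := le_add_of_le_of_nonneg (le_max_left _ _) (sq_nonneg _)
  have hA : (A : ℝ) ^ 2 ≤ max C 0 + (A : ℝ) ^ 2 := le_add_of_nonneg_left (le_max_right _ _)
  by_cases hAn : A * m ≤ n
  · exact (h m n hm₀ hAn).trans (mul_le_mul_of_nonneg_right hC hq0)
  · exact (real_zdFiveArmClusters_le_sq_mul hm1 hmn (not_le.1 hAn).le).trans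
      (mul_le_mul_of_nonneg_right hA hq0)

/-- **The classical route to two radii** (KSZ 1998, Lemma 5: (3.7) ⇒ (3.8); Nolin 2008, §4, two radii from one
radius by quasi-multiplicativity).  Fix an inner radius `m₁`.  IF
(U) the POINT upper bound `P_{1/2}(𝒜₅(A_{m₁,n})) ≤ C / n²` holds for all `n ≥ m₁`,
(Q) the LOWER quasi-multiplicativity `c · P(𝒜₅(A_{m₁,m})) · P(𝒜₅(A_{m,n})) ≤ P(𝒜₅(A_{m₁,n}))` holds for
    `m₁ ≤ m ≤ n` with some `c > 0` (gluing five arms across `∂B(m)`), and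
(L) the point LOWER bound `c' / m² ≤ P_{1/2}(𝒜₅(A_{m₁,m}))` holds for all `m ≥ m₁` with some `c' > 0`,
THEN `FiveArmUpperZ2` (constant `max C 0 / (c c')`, threshold `max m₁ 1`):
`P(𝒜₅(A_{m,n})) ≤ P(𝒜₅(A_{m₁,n})) / (c P(𝒜₅(A_{m₁,m}))) ≤ (C/n²) / (c c'/m²)`.  Nothing is asserted: (U), (Q),
(L) are the three classical inputs a from-scratch proof of the stub must supply. -/
theorem fiveArmUpperZ2_of_point_quasiMult : ∀ m₁ : ℕ, (∃ C : ℝ, ∀ n : ℕ, m₁ ≤ n → (bondPercolation (zdGraph 2) half).real (zdFiveArmClusters m₁ n) ≤ C / (n : ℝ) ^ 2) → (∃ c : ℝ, 0 < c ∧ ∀ m n : ℕ, m₁ ≤ m → m ≤ n → c * (bondPercolation (zdGraph 2) half).real (zdFiveArmClusters m₁ m) * (bondPercolation (zdGraph 2) half).real (zdFiveArmClusters m n) ≤ (bondPercolation (zdGraph 2) half).real (zdFiveArmClusters m₁ n)) → (∃ c : ℝ, 0 < c ∧ ∀ m : ℕ, m₁ ≤ m → c / (m : ℝ) ^ 2 ≤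 (bondPercolation (zdGraph 2) half).real (zdFiveArmClusters m₁ m)) → FiveArmUpperZ2 := by
  rintro m₁ ⟨C, hU⟩ ⟨c, hc, hQ⟩ ⟨c', hc', hL⟩
  set μ := bondPercolation (zdGraph 2) half with hμ
  refine ⟨max C 0 / (c * c'), max m₁ 1, fun m n hm hmn ↦ ?_⟩
  have hm₁ : m₁ ≤ m := le_of_max_le_left hm
  have hm1 : 1 ≤ m := le_of_max_le_right hm
  have hm0 : (0 : ℝ) < m := by exact_mod_cast hm1
  have hn0 : (0 : ℝ) < n := by exact_mod_cast (show 0 < n by omega)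
  -- (U) at the outer radius, with a nonnegative constant
  have hU' : μ.real (zdFiveArmClusters m₁ n) ≤ max C 0 / (n : ℝ) ^ 2 :=
    (hU n (hm₁.trans hmn)).trans (div_le_div_of_nonneg_right (le_max_left _ _) (by positivity))
  -- (Q) and (L): `(c c' / m²) · P(𝒜₅(A_{m,n})) ≤ P(𝒜₅(A_{m₁,n}))`
  have hP0 : 0 ≤ μ.real (zdFiveArmClusters m n) := measureReal_nonneg
  have hkey : c * c' / (m : ℝ) ^ 2 * μ.real (zdFiveArmClusters m n) ≤ max C 0 / (n : ℝ) ^ 2 := by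
    calc c * c' / (m : ℝ) ^ 2 * μ.real (zdFiveArmClusters m n)
        = c * (c' / (m : ℝ) ^ 2) * μ.real (zdFiveArmClusters m n) := by ring
      _ ≤ c * μ.real (zdFiveArmClusters m₁ m) * μ.real (zdFiveArmClusters m n) :=
          mul_le_mul_of_nonneg_right (mul_le_mul_of_nonneg_left (hL m hm₁) hc.le) hP0
      _ ≤ μ.real (zdFiveArmClusters m₁ n) := hQ m n hm₁ hmn
      _ ≤ max C 0 / (n : ℝ) ^ 2 := hU'
  have hpos : 0 < c * c' / (m : ℝ) ^ 2 := by positivity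
  rw [mul_comm] at hkey
  have := (le_div_iff₀ hpos).2 hkey
  refine this.trans (le_of_eq ?_)
  field_simp

end Summit.CriticalPhenomena.CardyFormulaZ2.Cruxes.NestingRigidity.PinchResampling

end
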